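import Literature.AnabelianGeometry.EtaleTheta.Discharge.Sec1Thm16iiiOfZNOriginClauses
import Literature.AnabelianGeometry.EtaleTheta.ThetaSettingOriginClauses
import Literature.AnabelianGeometry.EtaleTheta.Discharge.Sec1ZNUniquenessOfKummer
import HarnessLib

/-!
# [EtTh] Thm. 1.6 (iii): the K3 end-knit AT THE ORIGIN PREDICATES (v5) — theta companions compose,
# and the covering package {hY, haugN ∀N, R2} is read off `IsThm16Origin` / `IsTateOrigin`

Mochizuki, *The étale theta function and its Frobenioid-theoretic manifestations*, Publ. RIMS **45**
(2009), Thm. 1.6 (iii) p. 25 (printed 251); §1 pp. 12–14 (the setting, `Y_N`, `Z_N`)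
[cite: MochizukiEtTh2009, Thm 1.6 (iii) p.25].

abc-iut cell, layer L2, seat abc-iut-L2-t1 (§1 ROOT owner, gen 7). PROOF-ONLY knit (no definition, no
`Prop`-valued definition, no new named fact), consuming BY NAME: this lineage's K3 knits
`Thm16Sub.thm16iii_of_prop15iiiInv_of_originClauses` (p456637) and `Thm16Sub.haugJN_of_haugN` (p459263),
abc-iut-L2-t6's origin predicates `ThetaSetting.IsThm16Origin` / `ThetaSetting.IsTateOrigin`
(`ThetaSettingOriginClauses`: `map_GtpY_eq`, `gtpYN_fromCusp`, `exists_cuspidal_le_GtpY`, `thm16i`,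
`thetaCompanion`, `IsTateOrigin.gknIsKernelOfAction`) and abc-iut-w5-d051's
`Thm16Sub.haugN_of_isKernelOfAction` (`Discharge/Sec1Thm16GKN`).

* `ThetaSetting.ThetaCompanion.nonempty_symm` / `nonempty_trans` / `nonempty_conj` — theta companions
  (t1's structure `ThetaCompanion γ`: an isomorphism of theta quotients compatible with `γ` and carrying
  `Δ_Θ` onto `Δ_Θ`, Thm. 1.6 (ii) p. 24) INVERT and COMPOSE; hence the binder
  `cβ : ThetaCompanion (γ⁻¹ ≫ ια ≫ γ)` («the inversion automorphism of `β` obtained by transport», p. 25) of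
  `Thm16Sub.thm16iii_of_prop15iiiInv` (p445347) and of every later knit is REDUNDANT given the companions
  `c` of `γ` and `cα` of `ια` (companions are unique anyway: `ThetaCompanion.eq_of_comm`, p445127).
* `Thm16Sub.thm16iii_of_isKernelOfAction` — clause form: `thm16iii_of_prop15iiiInv_of_originClauses` with
  the `G_{K_N}`-membership transport haugN at EVERY level read off the p. 13 characterisation
  `GKNIsKernelOfAction` on each side separately, the `G_{J_N}`-membership transport haugJN from STRONG
  COMPLETENESS of `G_{ℚ_p}` (hypothesis `hsc`, verbatim the statement of the Summits-side theorem
  `Summit.ABC.IUTFork.stronglyComplete_GQp` of abc-iut-w5-d062, p461655 — a Literature file cannot import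
  it), and `cβ` eliminated.
* **`Thm16Sub.thm16iii_of_origins`** — [EtTh] Thm. 1.6 (iii) with the WHOLE group-theoretic covering
  package of the K3 table supplied from the origin predicates on both sides: leaf L02 `hY`
  (`IsThm16Origin.map_GtpY_eq`), leaf L04 `haugN` at EVERY level (`IsTateOrigin.gknIsKernelOfAction` +
  `haugN_of_isKernelOfAction`), R2 = L05 (`IsThm16Origin.gtpYN_fromCusp`), the cusp of `X^log` inside
  `Π^tp_Y` (`IsThm16Origin.exists_cuspidal_le_GtpY`). NET covering inputs of record after this file:
  {`IsThm16Origin` α β, `IsTateOrigin` α β, `hΔ` ([AbsAnab] Lem. 1.3.8), `h65` ([SemiAnbd] Thm. 6.5 (iii),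
  only through Thm. 1.6 (i)), strong completeness of `G_{ℚ_p}` (unconditional Summits-side), the origin
  clause `GtpZNFromSplitting` α β ∀N, and «lifted splittings over `G_{K_N}` exist on the `α` side ∀N»
  (p. 14) — the latter from ONE cusp section in `thm16iii_of_origins_of_cuspSection`}; the Prop. 1.5 /
  valuation / inversion / cusp-evaluation inputs are verbatim those of `thm16iii_of_prop15iiiInv`.
* `Thm16Sub.thm16iii_of_origins'` — the same with Thm. 1.6 (i) `h` and the theta companion `c` THEMSELVES
  read off the origin predicates (`thm16i_of_isThm16Origin`, `IsThm16Origin.thetaCompanion`).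

APPENDED v2 (K3 end-knit v6, same seat): `thm16iii_of_isKernelOfAction_of_znDef` / `thm16iii_of_origins_of_znDef` —
the origin clause `GtpZNFromSplitting` α β ∀N REPLACED by print's ∃-form definition of `Z_N` + the centrality clause `hcen`
of the p. 14 extension, through abc-iut-w5-d062's ROOT uniqueness theorem
`ThetaSetting.gtpZNFromSplitting_of_exists_of_stronglyComplete` (`Discharge/Sec1ZNUniquenessOfKummer`, p470538).

NON-VACUITY of record (numbers, not adjectives): `IsThm16Origin` is inhabited (abc-iut-w5-d165, p441852, at
`modelκ′`), `IsTateOrigin` at the stage-2 model `modelχq` (`modelχq_isTateOrigin`); a JOINT inhabitant of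
`IsThm16Origin ∧ IsTateOrigin` is the §1-interface residual of record (abc-iut-w5-d051; abc-iut-L2-lead
R550) — these knits are at print generality. HONEST FRAMING: [EtTh] is refereed; nothing asserted;
typed ≠ proved; nothing here bears on [IUTchIII] Cor. 3.12.
-/

noncomputable section

namespace Literature.AnabelianGeometry.EtaleTheta

open Literature.AnabelianGeometry.SemiGraphs

/-! ### Theta companions invert and compose -/

namespace ThetaSetting.ThetaCompanion

variable {p : ℕ} [Fact p.Prime] {D₁ D₂ D₃ : ThetaSetting p}

/-- The inverse of a theta companion of `γ` is a theta companion of `γ⁻¹` (Thm. 1.6 (ii), p. 24: the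
induced isomorphism of theta quotients). [cite: MochizukiEtTh2009, Thm 1.6 (ii) p.24] -/
theorem nonempty_symm {γ : D₁.PiTemp ≃ₜ* D₂.PiTemp} (c : ThetaCompanion γ) :
    Nonempty (ThetaCompanion γ.symm) := by
  refine ⟨{ thetaIso := c.thetaIso.symm, comm := fun y => ?_, map_deltaTheta := ?_ }⟩
  · -- `(γ⁻¹ y)^Θ = (γ^Θ)⁻¹ (y^Θ)` from `(γ x)^Θ = γ^Θ (x^Θ)` at `x := γ⁻¹ y`
    have h := c.comm (γ.symm.toMulEquiv y)
    have e : γ.toMulEquiv (γ.symm.toMulEquiv y) = y := γ.apply_symm_apply y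
    rw [e] at h
    change D₁.toTheta (γ.symm.toMulEquiv y) = c.thetaIso.symm (D₂.toTheta y)
    rw [h]
    exact (c.thetaIso.symm_apply_apply _).symm
  · ext x
    constructor
    · rintro ⟨y, hy, rfl⟩
      have hy' : y ∈ D₁.DeltaTheta.map c.thetaIso.toMulEquiv.toMonoidHom := by
        rw [c.map_deltaTheta]; exact hy
      obtain ⟨x, hx, rfl⟩ := hy'
      change c.thetaIso.symm (c.thetaIso x) ∈ D₁.DeltaTheta
      rw [c.thetaIso.symm_apply_apply]
      exact hx
    · intro hx
      refine ⟨c.thetaIso x, c.apply_mem ⟨x, hx⟩, ?_⟩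
      exact c.thetaIso.symm_apply_apply x

/-- Theta companions compose: companions of `γ` and `δ` give one of `γ ≫ δ`.
[cite: MochizukiEtTh2009, Thm 1.6 (ii) p.24] -/
theorem nonempty_trans {γ : D₁.PiTemp ≃ₜ* D₂.PiTemp} {δ : D₂.PiTemp ≃ₜ* D₃.PiTemp}
    (c : ThetaCompanion γ) (d : ThetaCompanion δ) : Nonempty (ThetaCompanion (γ.trans δ)) := by
  refine ⟨{ thetaIso := c.thetaIso.trans d.thetaIso, comm := fun x => ?_, map_deltaTheta := ?_ }⟩
  · change D₃.toTheta (δ.toMulEquiv (γ.toMulEquiv x)) = d.thetaIso (c.thetaIso (D₁.toTheta x))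
    rw [d.comm, c.comm]
    rfl
  · ext z
    constructor
    · rintro ⟨x, hx, rfl⟩
      exact d.apply_mem ⟨c.thetaIso x, c.apply_mem ⟨x, hx⟩⟩
    · intro hz
      have hz' : z ∈ D₂.DeltaTheta.map d.thetaIso.toMulEquiv.toMonoidHom := by
        rw [d.map_deltaTheta]; exact hz
      obtain ⟨y, hy, rfl⟩ := hz'
      have hy' : y ∈ D₁.DeltaTheta.map c.thetaIso.toMulEquiv.toMonoidHom := by
        rw [c.map_deltaTheta]; exact hy
      obtain ⟨x, hx, rfl⟩ := hy'
      exact ⟨x, hx, rfl⟩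

/-- **The transported inversion has a theta companion**: for companions `c` of
`γ : Π^tp_{Xα} ⥲ Π^tp_{Xβ}` and `cα` of an automorphism `ια` of `Π^tp_{Xα}`, the conjugate
`γ ∘ ια ∘ γ⁻¹` of `Π^tp_{Xβ}` has one («the corresponding inversion automorphism of `β`», proof of
Thm. 1.6 (iii), p. 25). Eliminates the binder `cβ` of `Thm16Sub.thm16iii_of_prop15iiiInv`.
[cite: MochizukiEtTh2009, Thm 1.6 (iii) p.25] -/
theorem nonempty_conj {γ : D₁.PiTemp ≃ₜ* D₂.PiTemp} {ι : D₁.PiTemp ≃ₜ* D₁.PiTemp}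
    (c : ThetaCompanion γ) (cι : ThetaCompanion ι) :
    Nonempty (ThetaCompanion ((γ.symm.trans ι).trans γ)) := by
  obtain ⟨c₁⟩ := nonempty_symm c
  obtain ⟨c₂⟩ := nonempty_trans c₁ cι
  exact nonempty_trans c₂ c

end ThetaSetting.ThetaCompanion

/-! ### The K3 end-knits -/

namespace Thm16Sub

variable {p : ℕ} [Fact p.Prime] {Dα Dβ : ThetaSetting p} {γ : Dα.PiTemp ≃ₜ* Dβ.PiTemp}

/-- **[EtTh] Theorem 1.6 (iii), the covering inputs as ONE-SETTING CLAUSES** (K3 end-knit v5, clause form): as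
`thm16iii_of_prop15iiiInv_of_originClauses` (p456637) with (a) the `G_{K_N}`-membership transport haugN at
every level READ OFF the p. 13 characterisation `G_{K_N} = Ker(G_K ↷ (Δ^tp_X)^ell/N·(Δ^tp_Y)^ell)` on each side
SEPARATELY (abc-iut-w5-d051's `haugN_of_isKernelOfAction`: given `hΔ`, `hY` it is ONE clause per setting, not
a statement about the pair), (b) the `G_{J_N}`-membership transport haugJN supplied by STRONG COMPLETENESS of
`G_{ℚ_p}` (`haugJN_of_haugN`, p459263; hypothesis `hsc` verbatim = `Summit.ABC.IUTFork.stronglyComplete_GQp p`,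
proved Summits-side by abc-iut-w5-d062, p461655), (c) NO theta companion of the transported inversion
`γ ∘ ια ∘ γ⁻¹` (`ThetaCompanion.nonempty_conj`). [cite: MochizukiEtTh2009, Thm 1.6 (iii) p.25] -/
theorem thm16iii_of_isKernelOfAction (h : ThetaSetting.Thm16i γ) (c : ThetaSetting.ThetaCompanion γ)
    (hΔ : Dα.DeltaTemp.map γ.toMulEquiv.toMonoidHom = Dβ.DeltaTemp)
    (hY : Dα.GtpY.map γ.toMulEquiv.toMonoidHom = Dβ.GtpY)
    (hKα : ∀ N, GKNIsKernelOfAction Dα N) (hKβ : ∀ N, GKNIsKernelOfAction Dβ N)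
    (hsc : ∀ H : Subgroup (GQp p), H.FiniteIndex → IsOpen (H : Set (GQp p)))
    (hcuspα : ∀ N, GtpYNFromCusp Dα N) (hcuspβ : ∀ N, GtpYNFromCusp Dβ N)
    (h65 : Dα.IsoPreservesCuspidalDecomp Dβ.toTemperedCurve)
    (hex : ∃ Dc : Subgroup Dα.PiTemp, Dα.IsCuspidalDecompositionGroup Dc ∧ Dc ≤ Dα.GtpY)
    (hzα : ∀ N, Dα.GtpZNFromSplitting N) (hsα : ∀ N : ℕ+, ∃ t, Dα.IsThetaSplittingAt N t)
    (hzβ : ∀ N, Dβ.GtpZNFromSplitting N)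
    (Eα : Dα.EtaleThetaData) (Eβ : Dβ.EtaleThetaData) (hCα : Dα.Compat) (hCβ : Dβ.Compat)
    (hSβ : Dβ.Sec2Hyps) (h15iiα : ThetaSetting.Prop15ii Eα.toKummerData hCα)
    (h15ii : ThetaSetting.Prop15ii Eβ.toKummerData hCβ)
    (h15α : ThetaSetting.Prop15iii Eα hCα) (h15β : ThetaSetting.Prop15iii Eβ hCβ)
    {σ : Dβ.PiTemp} (hσ : σ ∈ Dβ.GtpYdd)
    (Vα : ThetaSetting.ValuationHatData Dα Eα.toKummerData)
    (Vβ : ThetaSetting.ValuationHatData Dβ Eβ.toKummerData)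
    (hVα : Vα.unitsHat = Dα.unitsOKdd.map Eα.toKddHat) (hVβ : Vβ.unitsHat = Dβ.unitsOKdd.map Eβ.toKddHat)
    (h16ii : ThetaSetting.Thm16ii γ h Eα.toKummerData Eβ.toKummerData Vα Vβ)
    (hTβ : Dβ.HasThetaTopology) (hOβ : Dβ.IsEtThOrigin)
    {lamβ : ↥((Dβ.DtpYddN 1).map Dβ.toTheta) →ₜ* Dβ.DeltaTheta} (hstdβ : ThetaSetting.IsStdLog lamβ)
    (hresβ : ContH1.res (MonoidHom.id Dβ.GtpTheta) Dβ.DeltaTheta Dβ.map_toTheta_DtpYddN_one_le Eβ.logUdd =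
      ThetaSetting.homClass ThetaSetting.dtpYddTheta_le_deltaTheta_map lamβ)
    {ια : Dα.PiTemp ≃ₜ* Dα.PiTemp} (hια : Dα.IsInversionAut ια) (cα : ThetaSetting.ThetaCompanion ια)
    (hInvα : ThetaSetting.InvClauses Eα hια cα)
    (h15invβ : Dβ.Prop15iiiInvAnchored Eβ)
    (yβ : ThetaSetting.CuspidalPointDd Eβ.toKummerData) (hyβA : yβ.IsAnchored) (hyβ0 : yβ.IsOnLabelZero)
    (hyβfix : Dβ.FixesCuspBelow ((γ.symm.trans ια).trans γ) yβ)
    (y : ThetaSetting.CuspidalPointDd Eβ.toKummerData) {u₁ u₂ v₁ v₂ : (↥Dβ.Kdd)ˣ}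
    (hu₁ : u₁ ∈ Dβ.unitsOKdd) (hu₂ : u₂ ∈ Dβ.unitsOKdd)
    (hv : ‖((v₁ : Dβ.Kdd) : PadicAlgCl p)‖ = ‖((v₂ : Dβ.Kdd) : PadicAlgCl p)‖)
    (h₁ : haveI := hCβ.GtpYdd_normal
      y.evalAt (ContH1.res Dβ.toTheta Dβ.DeltaTheta (y.sec_le.trans y.Dpt_le)
        (ContH1.conj Dβ.toTheta Dβ.DeltaTheta σ Eβ.etaDd)) = Eβ.toKddHat (u₁ * v₁))
    (h₂ : y.evalAt (ContH1.res Dβ.toTheta Dβ.DeltaTheta (y.sec_le.trans y.Dpt_le)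
        (ThetaSetting.transport c h Eα.etaDd)) = Eβ.toKddHat (u₂ * v₂)) :
    ThetaSetting.Thm16iii γ h c Eα Eβ hCβ := by
  obtain ⟨cβ⟩ := ThetaSetting.ThetaCompanion.nonempty_conj c cα
  have haugN : ∀ (N : ℕ+) (g : Dα.PiTemp), Dβ.aug (γ.toMulEquiv g) ∈ Dβ.GKN N ↔ Dα.aug g ∈ Dα.GKN N :=
    fun N => haugN_of_isKernelOfAction γ hΔ hY N (hKα N) (hKβ N)
  exact thm16iii_of_prop15iiiInv_of_originClauses h c hΔ hY haugN
    (fun N g => haugJN_of_haugN Dα Dβ γ hΔ N (haugN N) hsc g) hcuspα hcuspβ h65 hex hzα hsα hzβ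
    Eα Eβ hCα hCβ hSβ h15iiα h15ii h15α h15β hσ Vα Vβ hVα hVβ h16ii
    hTβ hOβ hstdβ hresβ hια cα hInvα cβ h15invβ yβ hyβA hyβ0 hyβfix y hu₁ hu₂ hv h₁ h₂

/-- **[EtTh] Theorem 1.6 (iii) AT THE ORIGIN PREDICATES** (K3 end-knit v5): for settings `α`, `β` satisfying
the origin clauses of §1 (`IsThm16Origin`: R1, R2 for every `N`, the cusp of `X^log` inside `Π^tp_Y`, R3, (TM₂))
and the print-faithful Tate-module clause at every level (`IsTateOrigin`), the covering inputs of the K3 table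
are THEOREMS read off the predicates — leaf L02 `hY` (`IsThm16Origin.map_GtpY_eq`), leaf L04 `haugN` at every
level (`IsTateOrigin.gknIsKernelOfAction` on both sides), R2 = L05 (`gtpYN_fromCusp`), the cuspidal
decomposition group in `Π^tp_{Yα}` (`exists_cuspidal_le_GtpY`). So Thm. 1.6 (iii) follows from: `hΔ`
([AbsAnab] Lem. 1.3.8), [SemiAnbd] Thm. 6.5 (iii) `h65`, strong completeness of `G_{ℚ_p}` («[by the definition
of `J_N`]», p. 14; unconditional Summits-side), the origin clause `GtpZNFromSplitting` on both sides, «lifted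
splittings over `G_{K_N}` exist» on the `α` side (p. 14), the theta companion `cα` of the inversion `ια` only,
and the Prop. 1.5 / valuation / inversion / cusp-evaluation inputs of `thm16iii_of_prop15iiiInv` verbatim.
NON-VACUITY (numbers, not adjectives): `IsThm16Origin` is inhabited at `modelκ′` (p441852) and `IsTateOrigin`
at the stage-2 model `modelχq` (`modelχq_isTateOrigin`); a JOINT inhabitant of `IsThm16Origin ∧ IsTateOrigin`
is the §1-interface residual of record (abc-iut-w5-d051, R550: GT-type cusp-normalising automorphisms) —
this knit is at print generality.
[cite: MochizukiEtTh2009, Thm 1.6 (iii) p.25] -/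
theorem thm16iii_of_origins (hα : Dα.IsThm16Origin) (hβ : Dβ.IsThm16Origin)
    (hTα : Dα.IsTateOrigin) (hTβ' : Dβ.IsTateOrigin)
    (h : ThetaSetting.Thm16i γ) (c : ThetaSetting.ThetaCompanion γ)
    (hΔ : Dα.DeltaTemp.map γ.toMulEquiv.toMonoidHom = Dβ.DeltaTemp)
    (h65 : Dα.IsoPreservesCuspidalDecomp Dβ.toTemperedCurve)
    (hsc : ∀ H : Subgroup (GQp p), H.FiniteIndex → IsOpen (H : Set (GQp p)))
    (hzα : ∀ N, Dα.GtpZNFromSplitting N) (hsα : ∀ N : ℕ+, ∃ t, Dα.IsThetaSplittingAt N t)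
    (hzβ : ∀ N, Dβ.GtpZNFromSplitting N)
    (Eα : Dα.EtaleThetaData) (Eβ : Dβ.EtaleThetaData) (hCα : Dα.Compat) (hCβ : Dβ.Compat)
    (hSβ : Dβ.Sec2Hyps) (h15iiα : ThetaSetting.Prop15ii Eα.toKummerData hCα)
    (h15ii : ThetaSetting.Prop15ii Eβ.toKummerData hCβ)
    (h15α : ThetaSetting.Prop15iii Eα hCα) (h15β : ThetaSetting.Prop15iii Eβ hCβ)
    {σ : Dβ.PiTemp} (hσ : σ ∈ Dβ.GtpYdd)
    (Vα : ThetaSetting.ValuationHatData Dα Eα.toKummerData)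
    (Vβ : ThetaSetting.ValuationHatData Dβ Eβ.toKummerData)
    (hVα : Vα.unitsHat = Dα.unitsOKdd.map Eα.toKddHat) (hVβ : Vβ.unitsHat = Dβ.unitsOKdd.map Eβ.toKddHat)
    (h16ii : ThetaSetting.Thm16ii γ h Eα.toKummerData Eβ.toKummerData Vα Vβ)
    (hTβ : Dβ.HasThetaTopology) (hOβ : Dβ.IsEtThOrigin)
    {lamβ : ↥((Dβ.DtpYddN 1).map Dβ.toTheta) →ₜ* Dβ.DeltaTheta} (hstdβ : ThetaSetting.IsStdLog lamβ)
    (hresβ : ContH1.res (MonoidHom.id Dβ.GtpTheta) Dβ.DeltaTheta Dβ.map_toTheta_DtpYddN_one_le Eβ.logUdd =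
      ThetaSetting.homClass ThetaSetting.dtpYddTheta_le_deltaTheta_map lamβ)
    {ια : Dα.PiTemp ≃ₜ* Dα.PiTemp} (hια : Dα.IsInversionAut ια) (cα : ThetaSetting.ThetaCompanion ια)
    (hInvα : ThetaSetting.InvClauses Eα hια cα)
    (h15invβ : Dβ.Prop15iiiInvAnchored Eβ)
    (yβ : ThetaSetting.CuspidalPointDd Eβ.toKummerData) (hyβA : yβ.IsAnchored) (hyβ0 : yβ.IsOnLabelZero)
    (hyβfix : Dβ.FixesCuspBelow ((γ.symm.trans ια).trans γ) yβ)
    (y : ThetaSetting.CuspidalPointDd Eβ.toKummerData) {u₁ u₂ v₁ v₂ : (↥Dβ.Kdd)ˣ}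
    (hu₁ : u₁ ∈ Dβ.unitsOKdd) (hu₂ : u₂ ∈ Dβ.unitsOKdd)
    (hv : ‖((v₁ : Dβ.Kdd) : PadicAlgCl p)‖ = ‖((v₂ : Dβ.Kdd) : PadicAlgCl p)‖)
    (h₁ : haveI := hCβ.GtpYdd_normal
      y.evalAt (ContH1.res Dβ.toTheta Dβ.DeltaTheta (y.sec_le.trans y.Dpt_le)
        (ContH1.conj Dβ.toTheta Dβ.DeltaTheta σ Eβ.etaDd)) = Eβ.toKddHat (u₁ * v₁))
    (h₂ : y.evalAt (ContH1.res Dβ.toTheta Dβ.DeltaTheta (y.sec_le.trans y.Dpt_le)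
        (ThetaSetting.transport c h Eα.etaDd)) = Eβ.toKddHat (u₂ * v₂)) :
    ThetaSetting.Thm16iii γ h c Eα Eβ hCβ :=
  thm16iii_of_isKernelOfAction h c hΔ (hα.map_GtpY_eq hβ γ) hTα.gknIsKernelOfAction hTβ'.gknIsKernelOfAction
    hsc hα.gtpYN_fromCusp hβ.gtpYN_fromCusp h65 hα.exists_cuspidal_le_GtpY hzα hsα hzβ
    Eα Eβ hCα hCβ hSβ h15iiα h15ii h15α h15β hσ Vα Vβ hVα hVβ h16ii
    hTβ hOβ hstdβ hresβ hια cα hInvα h15invβ yβ hyβA hyβ0 hyβfix y hu₁ hu₂ hv h₁ h₂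

/-- **Theorem 1.6 (iii) at the origin predicates, the `α`-side splittings from ONE cusp section**
`s : G_{Kα} → D_c ≤ Π^tp_{Yα}` (pp. 13–14: «any decomposition group of a cusp … determines … a section»;
`exists_thetaSplittingAt_of_cuspSection`, p456637, with R2 from `IsThm16Origin.gtpYN_fromCusp`).
[cite: MochizukiEtTh2009, Thm 1.6 (iii) p.25] -/
theorem thm16iii_of_origins_of_cuspSection (hα : Dα.IsThm16Origin) (hβ : Dβ.IsThm16Origin)
    (hTα : Dα.IsTateOrigin) (hTβ' : Dβ.IsTateOrigin)
    (h : ThetaSetting.Thm16i γ) (c : ThetaSetting.ThetaCompanion γ)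
    (hΔ : Dα.DeltaTemp.map γ.toMulEquiv.toMonoidHom = Dβ.DeltaTemp)
    (h65 : Dα.IsoPreservesCuspidalDecomp Dβ.toTemperedCurve)
    (hsc : ∀ H : Subgroup (GQp p), H.FiniteIndex → IsOpen (H : Set (GQp p)))
    {Dc : Subgroup Dα.PiTemp} (hDc : Dα.IsCuspidalDecompositionGroup Dc) (hDcY : Dc ≤ Dα.GtpY)
    (s : GQp p →* Dα.PiTemp) (hsec : ∀ g : GQp p, g ∈ Dα.GK → Dα.aug (s g) = g) (hsD : Dα.GK.map s ≤ Dc)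
    (hzα : ∀ N, Dα.GtpZNFromSplitting N) (hzβ : ∀ N, Dβ.GtpZNFromSplitting N)
    (Eα : Dα.EtaleThetaData) (Eβ : Dβ.EtaleThetaData) (hCα : Dα.Compat) (hCβ : Dβ.Compat)
    (hSβ : Dβ.Sec2Hyps) (h15iiα : ThetaSetting.Prop15ii Eα.toKummerData hCα)
    (h15ii : ThetaSetting.Prop15ii Eβ.toKummerData hCβ)
    (h15α : ThetaSetting.Prop15iii Eα hCα) (h15β : ThetaSetting.Prop15iii Eβ hCβ)
    {σ : Dβ.PiTemp} (hσ : σ ∈ Dβ.GtpYdd)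
    (Vα : ThetaSetting.ValuationHatData Dα Eα.toKummerData)
    (Vβ : ThetaSetting.ValuationHatData Dβ Eβ.toKummerData)
    (hVα : Vα.unitsHat = Dα.unitsOKdd.map Eα.toKddHat) (hVβ : Vβ.unitsHat = Dβ.unitsOKdd.map Eβ.toKddHat)
    (h16ii : ThetaSetting.Thm16ii γ h Eα.toKummerData Eβ.toKummerData Vα Vβ)
    (hTβ : Dβ.HasThetaTopology) (hOβ : Dβ.IsEtThOrigin)
    {lamβ : ↥((Dβ.DtpYddN 1).map Dβ.toTheta) →ₜ* Dβ.DeltaTheta} (hstdβ : ThetaSetting.IsStdLog lamβ)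
    (hresβ : ContH1.res (MonoidHom.id Dβ.GtpTheta) Dβ.DeltaTheta Dβ.map_toTheta_DtpYddN_one_le Eβ.logUdd =
      ThetaSetting.homClass ThetaSetting.dtpYddTheta_le_deltaTheta_map lamβ)
    {ια : Dα.PiTemp ≃ₜ* Dα.PiTemp} (hια : Dα.IsInversionAut ια) (cα : ThetaSetting.ThetaCompanion ια)
    (hInvα : ThetaSetting.InvClauses Eα hια cα)
    (h15invβ : Dβ.Prop15iiiInvAnchored Eβ)
    (yβ : ThetaSetting.CuspidalPointDd Eβ.toKummerData) (hyβA : yβ.IsAnchored) (hyβ0 : yβ.IsOnLabelZero)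
    (hyβfix : Dβ.FixesCuspBelow ((γ.symm.trans ια).trans γ) yβ)
    (y : ThetaSetting.CuspidalPointDd Eβ.toKummerData) {u₁ u₂ v₁ v₂ : (↥Dβ.Kdd)ˣ}
    (hu₁ : u₁ ∈ Dβ.unitsOKdd) (hu₂ : u₂ ∈ Dβ.unitsOKdd)
    (hv : ‖((v₁ : Dβ.Kdd) : PadicAlgCl p)‖ = ‖((v₂ : Dβ.Kdd) : PadicAlgCl p)‖)
    (h₁ : haveI := hCβ.GtpYdd_normal
      y.evalAt (ContH1.res Dβ.toTheta Dβ.DeltaTheta (y.sec_le.trans y.Dpt_le)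
        (ContH1.conj Dβ.toTheta Dβ.DeltaTheta σ Eβ.etaDd)) = Eβ.toKddHat (u₁ * v₁))
    (h₂ : y.evalAt (ContH1.res Dβ.toTheta Dβ.DeltaTheta (y.sec_le.trans y.Dpt_le)
        (ThetaSetting.transport c h Eα.etaDd)) = Eβ.toKddHat (u₂ * v₂)) :
    ThetaSetting.Thm16iii γ h c Eα Eβ hCβ :=
  thm16iii_of_origins hα hβ hTα hTβ' h c hΔ h65 hsc hzα
    (fun N => exists_thetaSplittingAt_of_cuspSection Dα hDc hDcY s hsec hsD N (hα.gtpYN_fromCusp N)) hzβ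
    Eα Eβ hCα hCβ hSβ h15iiα h15ii h15α h15β hσ Vα Vβ hVα hVβ h16ii
    hTβ hOβ hstdβ hresβ hια cα hInvα h15invβ yβ hyβA hyβ0 hyβfix y hu₁ hu₂ hv h₁ h₂

/-- **Theorem 1.6 (iii) at the origin predicates with (i) and the theta companion READ OFF the predicates**:
Thm. 1.6 (i) is `thm16i_of_isThm16Origin` (from `hΔ`, `h65`) and «`γ` induces an isomorphism
`(Δ_Θ)α ⥲ (Δ_Θ)β`» (Thm. 1.6 (ii)) is `IsThm16Origin.thetaCompanion` (R3, quotient topologies); the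
conclusion is stated for THAT `h` and THAT companion (any other companion coincides with it,
`ThetaCompanion.eq_of_comm`, p445127). [cite: MochizukiEtTh2009, Thm 1.6 (iii) p.25] -/
theorem thm16iii_of_origins' (hα : Dα.IsThm16Origin) (hβ : Dβ.IsThm16Origin)
    (hTα : Dα.IsTateOrigin) (hTβ' : Dβ.IsTateOrigin)
    (hΔ : Dα.DeltaTemp.map γ.toMulEquiv.toMonoidHom = Dβ.DeltaTemp)
    (h65 : Dα.IsoPreservesCuspidalDecomp Dβ.toTemperedCurve)
    (hsc : ∀ H : Subgroup (GQp p), H.FiniteIndex → IsOpen (H : Set (GQp p)))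
    (hzα : ∀ N, Dα.GtpZNFromSplitting N) (hsα : ∀ N : ℕ+, ∃ t, Dα.IsThetaSplittingAt N t)
    (hzβ : ∀ N, Dβ.GtpZNFromSplitting N)
    (Eα : Dα.EtaleThetaData) (Eβ : Dβ.EtaleThetaData) (hCα : Dα.Compat) (hCβ : Dβ.Compat)
    (hSβ : Dβ.Sec2Hyps) (h15iiα : ThetaSetting.Prop15ii Eα.toKummerData hCα)
    (h15ii : ThetaSetting.Prop15ii Eβ.toKummerData hCβ)
    (h15α : ThetaSetting.Prop15iii Eα hCα) (h15β : ThetaSetting.Prop15iii Eβ hCβ)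
    {σ : Dβ.PiTemp} (hσ : σ ∈ Dβ.GtpYdd)
    (Vα : ThetaSetting.ValuationHatData Dα Eα.toKummerData)
    (Vβ : ThetaSetting.ValuationHatData Dβ Eβ.toKummerData)
    (hVα : Vα.unitsHat = Dα.unitsOKdd.map Eα.toKddHat) (hVβ : Vβ.unitsHat = Dβ.unitsOKdd.map Eβ.toKddHat)
    (h16ii : ThetaSetting.Thm16ii γ (thm16i_of_isThm16Origin hα hβ γ hΔ h65) Eα.toKummerData
      Eβ.toKummerData Vα Vβ)
    (hTβ : Dβ.HasThetaTopology) (hOβ : Dβ.IsEtThOrigin)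
    {lamβ : ↥((Dβ.DtpYddN 1).map Dβ.toTheta) →ₜ* Dβ.DeltaTheta} (hstdβ : ThetaSetting.IsStdLog lamβ)
    (hresβ : ContH1.res (MonoidHom.id Dβ.GtpTheta) Dβ.DeltaTheta Dβ.map_toTheta_DtpYddN_one_le Eβ.logUdd =
      ThetaSetting.homClass ThetaSetting.dtpYddTheta_le_deltaTheta_map lamβ)
    {ια : Dα.PiTemp ≃ₜ* Dα.PiTemp} (hια : Dα.IsInversionAut ια) (cα : ThetaSetting.ThetaCompanion ια)
    (hInvα : ThetaSetting.InvClauses Eα hια cα)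
    (h15invβ : Dβ.Prop15iiiInvAnchored Eβ)
    (yβ : ThetaSetting.CuspidalPointDd Eβ.toKummerData) (hyβA : yβ.IsAnchored) (hyβ0 : yβ.IsOnLabelZero)
    (hyβfix : Dβ.FixesCuspBelow ((γ.symm.trans ια).trans γ) yβ)
    (y : ThetaSetting.CuspidalPointDd Eβ.toKummerData) {u₁ u₂ v₁ v₂ : (↥Dβ.Kdd)ˣ}
    (hu₁ : u₁ ∈ Dβ.unitsOKdd) (hu₂ : u₂ ∈ Dβ.unitsOKdd)
    (hv : ‖((v₁ : Dβ.Kdd) : PadicAlgCl p)‖ = ‖((v₂ : Dβ.Kdd) : PadicAlgCl p)‖)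
    (h₁ : haveI := hCβ.GtpYdd_normal
      y.evalAt (ContH1.res Dβ.toTheta Dβ.DeltaTheta (y.sec_le.trans y.Dpt_le)
        (ContH1.conj Dβ.toTheta Dβ.DeltaTheta σ Eβ.etaDd)) = Eβ.toKddHat (u₁ * v₁))
    (h₂ : y.evalAt (ContH1.res Dβ.toTheta Dβ.DeltaTheta (y.sec_le.trans y.Dpt_le)
        (ThetaSetting.transport (hα.thetaCompanion hβ γ hΔ) (thm16i_of_isThm16Origin hα hβ γ hΔ h65)
          Eα.etaDd)) = Eβ.toKddHat (u₂ * v₂)) :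
    ThetaSetting.Thm16iii γ (thm16i_of_isThm16Origin hα hβ γ hΔ h65) (hα.thetaCompanion hβ γ hΔ)
      Eα Eβ hCβ :=
  thm16iii_of_origins hα hβ hTα hTβ' (thm16i_of_isThm16Origin hα hβ γ hΔ h65) (hα.thetaCompanion hβ γ hΔ)
    hΔ h65 hsc hzα hsα hzβ
    Eα Eβ hCα hCβ hSβ h15iiα h15ii h15α h15β hσ Vα Vβ hVα hVβ h16ii
    hTβ hOβ hstdβ hresβ hια cα hInvα h15invβ yβ hyβA hyβ0 hyβfix y hu₁ hu₂ hv h₁ h₂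

/-! ### Appended v2: K3 END-KNIT v6 — the origin clause `GtpZNFromSplitting` replaced by print's DEFINITION of `Z_N`
(the ∃-form) + the structural clause «`Π^tp_{Y_N}` centralises `(Δ^tp_{Y_N})^Θ` modulo `N·(Δ^tp_Y)^Θ`», through
abc-iut-w5-d062's ROOT uniqueness theorem `ThetaSetting.gtpZNFromSplitting_of_exists_of_stronglyComplete` (p470538) -/

/-- **[EtTh] Theorem 1.6 (iii), K3 end-knit v6 (clause form)**: as `thm16iii_of_isKernelOfAction`, the ∀-form origin clause
`GtpZNFromSplitting` on each side REPLACED by print's definition of `Z_N` — SOME lifted splitting over `G_{K_N}` cuts out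
`Π^tp_{Z_N}` (the ∃-form, p. 14) — together with the printed structure of the extension
`1 → Δ_Θ ⊗ ℤ/N → (Π^tp_{Y_N})^Θ/N·(Δ^tp_Y)^Θ → G_{K_N} → 1` («`Π^tp_{Y_N}` centralises `(Δ^tp_{Y_N})^Θ` mod `N·(Δ^tp_Y)^Θ`»,
`hcen`), via abc-iut-w5-d062's «all splittings determine the same splitting over `G_{J_N}`» AT THE ROOT
(`gtpZNFromSplitting_of_exists_of_stronglyComplete`, p470538; strong completeness `hsc` already a binder here); the
α-side binder «lifted splittings exist» is now implied by `hexα`. [cite: MochizukiEtTh2009, Thm 1.6 (iii) p.25] -/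
theorem thm16iii_of_isKernelOfAction_of_znDef (h : ThetaSetting.Thm16i γ) (c : ThetaSetting.ThetaCompanion γ)
    (hΔ : Dα.DeltaTemp.map γ.toMulEquiv.toMonoidHom = Dβ.DeltaTemp)
    (hY : Dα.GtpY.map γ.toMulEquiv.toMonoidHom = Dβ.GtpY)
    (hKα : ∀ N, GKNIsKernelOfAction Dα N) (hKβ : ∀ N, GKNIsKernelOfAction Dβ N)
    (hsc : ∀ H : Subgroup (GQp p), H.FiniteIndex → IsOpen (H : Set (GQp p)))
    (hcuspα : ∀ N, GtpYNFromCusp Dα N) (hcuspβ : ∀ N, GtpYNFromCusp Dβ N)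
    (h65 : Dα.IsoPreservesCuspidalDecomp Dβ.toTemperedCurve)
    (hex : ∃ Dc : Subgroup Dα.PiTemp, Dα.IsCuspidalDecompositionGroup Dc ∧ Dc ≤ Dα.GtpY)
    (hcenα : ∀ N : ℕ+, ∀ g ∈ Dα.GtpYN N, ∀ y' ∈ Dα.DtpYN N,
      Dα.toTheta g * Dα.toTheta y' * (Dα.toTheta g)⁻¹ * (Dα.toTheta y')⁻¹ ∈ Dα.thetaPowersY N)
    (hexα : ∀ N : ℕ+, ∃ s₀ : ↥(Dα.GKN N) → Dα.GtpTheta, Dα.IsThetaSplittingAt N s₀ ∧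
      ∀ g : Dα.PiTemp, g ∈ Dα.GtpZN N ↔ g ∈ Dα.GtpYN N ∧ ∃ h' : Dα.aug g ∈ Dα.GJN N,
        Dα.toTheta g * (s₀ ⟨Dα.aug g, Dα.GJN_le_GKN N h'⟩)⁻¹ ∈ Dα.thetaPowersY N)
    (hcenβ : ∀ N : ℕ+, ∀ g ∈ Dβ.GtpYN N, ∀ y' ∈ Dβ.DtpYN N,
      Dβ.toTheta g * Dβ.toTheta y' * (Dβ.toTheta g)⁻¹ * (Dβ.toTheta y')⁻¹ ∈ Dβ.thetaPowersY N)
    (hexβ : ∀ N : ℕ+, ∃ s₀ : ↥(Dβ.GKN N) → Dβ.GtpTheta, Dβ.IsThetaSplittingAt N s₀ ∧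
      ∀ g : Dβ.PiTemp, g ∈ Dβ.GtpZN N ↔ g ∈ Dβ.GtpYN N ∧ ∃ h' : Dβ.aug g ∈ Dβ.GJN N,
        Dβ.toTheta g * (s₀ ⟨Dβ.aug g, Dβ.GJN_le_GKN N h'⟩)⁻¹ ∈ Dβ.thetaPowersY N)
    (Eα : Dα.EtaleThetaData) (Eβ : Dβ.EtaleThetaData) (hCα : Dα.Compat) (hCβ : Dβ.Compat)
    (hSβ : Dβ.Sec2Hyps) (h15iiα : ThetaSetting.Prop15ii Eα.toKummerData hCα)
    (h15ii : ThetaSetting.Prop15ii Eβ.toKummerData hCβ)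
    (h15α : ThetaSetting.Prop15iii Eα hCα) (h15β : ThetaSetting.Prop15iii Eβ hCβ)
    {σ : Dβ.PiTemp} (hσ : σ ∈ Dβ.GtpYdd)
    (Vα : ThetaSetting.ValuationHatData Dα Eα.toKummerData)
    (Vβ : ThetaSetting.ValuationHatData Dβ Eβ.toKummerData)
    (hVα : Vα.unitsHat = Dα.unitsOKdd.map Eα.toKddHat) (hVβ : Vβ.unitsHat = Dβ.unitsOKdd.map Eβ.toKddHat)
    (h16ii : ThetaSetting.Thm16ii γ h Eα.toKummerData Eβ.toKummerData Vα Vβ)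
    (hTβ : Dβ.HasThetaTopology) (hOβ : Dβ.IsEtThOrigin)
    {lamβ : ↥((Dβ.DtpYddN 1).map Dβ.toTheta) →ₜ* Dβ.DeltaTheta} (hstdβ : ThetaSetting.IsStdLog lamβ)
    (hresβ : ContH1.res (MonoidHom.id Dβ.GtpTheta) Dβ.DeltaTheta Dβ.map_toTheta_DtpYddN_one_le Eβ.logUdd =
      ThetaSetting.homClass ThetaSetting.dtpYddTheta_le_deltaTheta_map lamβ)
    {ια : Dα.PiTemp ≃ₜ* Dα.PiTemp} (hια : Dα.IsInversionAut ια) (cα : ThetaSetting.ThetaCompanion ια)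
    (hInvα : ThetaSetting.InvClauses Eα hια cα)
    (h15invβ : Dβ.Prop15iiiInvAnchored Eβ)
    (yβ : ThetaSetting.CuspidalPointDd Eβ.toKummerData) (hyβA : yβ.IsAnchored) (hyβ0 : yβ.IsOnLabelZero)
    (hyβfix : Dβ.FixesCuspBelow ((γ.symm.trans ια).trans γ) yβ)
    (y : ThetaSetting.CuspidalPointDd Eβ.toKummerData) {u₁ u₂ v₁ v₂ : (↥Dβ.Kdd)ˣ}
    (hu₁ : u₁ ∈ Dβ.unitsOKdd) (hu₂ : u₂ ∈ Dβ.unitsOKdd)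
    (hv : ‖((v₁ : Dβ.Kdd) : PadicAlgCl p)‖ = ‖((v₂ : Dβ.Kdd) : PadicAlgCl p)‖)
    (h₁ : haveI := hCβ.GtpYdd_normal
      y.evalAt (ContH1.res Dβ.toTheta Dβ.DeltaTheta (y.sec_le.trans y.Dpt_le)
        (ContH1.conj Dβ.toTheta Dβ.DeltaTheta σ Eβ.etaDd)) = Eβ.toKddHat (u₁ * v₁))
    (h₂ : y.evalAt (ContH1.res Dβ.toTheta Dβ.DeltaTheta (y.sec_le.trans y.Dpt_le)
        (ThetaSetting.transport c h Eα.etaDd)) = Eβ.toKddHat (u₂ * v₂)) :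
    ThetaSetting.Thm16iii γ h c Eα Eβ hCβ :=
  thm16iii_of_isKernelOfAction h c hΔ hY hKα hKβ hsc hcuspα hcuspβ h65 hex
    (fun N => Dα.gtpZNFromSplitting_of_exists_of_stronglyComplete hsc (hcenα N) (hexα N))
    (fun N => by obtain ⟨s₀, hs₀, -⟩ := hexα N; exact ⟨s₀, hs₀⟩)
    (fun N => Dβ.gtpZNFromSplitting_of_exists_of_stronglyComplete hsc (hcenβ N) (hexβ N))
    Eα Eβ hCα hCβ hSβ h15iiα h15ii h15α h15β hσ Vα Vβ hVα hVβ h16ii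
    hTβ hOβ hstdβ hresβ hια cα hInvα h15invβ yβ hyβA hyβ0 hyβfix y hu₁ hu₂ hv h₁ h₂

/-- **[EtTh] Theorem 1.6 (iii) AT THE ORIGIN PREDICATES, K3 end-knit v6**: as `thm16iii_of_origins` (v5) with the origin clause
`GtpZNFromSplitting` α β ∀N REPLACED by {∃-form of `Z_N` (print's definition), `hcen`} on each side (w5-d062's root uniqueness
theorem); the separate binder «lifted splittings exist on α» is GONE (implied). NET covering inputs of record after v6:
{`IsThm16Origin` α β, `IsTateOrigin` α β, `hΔ`, `h65`, `hsc` (Summits-side theorem), and per side the two DISPLAYED printed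
clauses of p. 14: the ∃-form definition of `Z_N` and the centrality clause `hcen`}. [cite: MochizukiEtTh2009, Thm 1.6 (iii) p.25] -/
theorem thm16iii_of_origins_of_znDef (hα : Dα.IsThm16Origin) (hβ : Dβ.IsThm16Origin)
    (hTα : Dα.IsTateOrigin) (hTβ' : Dβ.IsTateOrigin)
    (h : ThetaSetting.Thm16i γ) (c : ThetaSetting.ThetaCompanion γ)
    (hΔ : Dα.DeltaTemp.map γ.toMulEquiv.toMonoidHom = Dβ.DeltaTemp)
    (h65 : Dα.IsoPreservesCuspidalDecomp Dβ.toTemperedCurve)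
    (hsc : ∀ H : Subgroup (GQp p), H.FiniteIndex → IsOpen (H : Set (GQp p)))
    (hcenα : ∀ N : ℕ+, ∀ g ∈ Dα.GtpYN N, ∀ y' ∈ Dα.DtpYN N,
      Dα.toTheta g * Dα.toTheta y' * (Dα.toTheta g)⁻¹ * (Dα.toTheta y')⁻¹ ∈ Dα.thetaPowersY N)
    (hexα : ∀ N : ℕ+, ∃ s₀ : ↥(Dα.GKN N) → Dα.GtpTheta, Dα.IsThetaSplittingAt N s₀ ∧
      ∀ g : Dα.PiTemp, g ∈ Dα.GtpZN N ↔ g ∈ Dα.GtpYN N ∧ ∃ h' : Dα.aug g ∈ Dα.GJN N,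
        Dα.toTheta g * (s₀ ⟨Dα.aug g, Dα.GJN_le_GKN N h'⟩)⁻¹ ∈ Dα.thetaPowersY N)
    (hcenβ : ∀ N : ℕ+, ∀ g ∈ Dβ.GtpYN N, ∀ y' ∈ Dβ.DtpYN N,
      Dβ.toTheta g * Dβ.toTheta y' * (Dβ.toTheta g)⁻¹ * (Dβ.toTheta y')⁻¹ ∈ Dβ.thetaPowersY N)
    (hexβ : ∀ N : ℕ+, ∃ s₀ : ↥(Dβ.GKN N) → Dβ.GtpTheta, Dβ.IsThetaSplittingAt N s₀ ∧
      ∀ g : Dβ.PiTemp, g ∈ Dβ.GtpZN N ↔ g ∈ Dβ.GtpYN N ∧ ∃ h' : Dβ.aug g ∈ Dβ.GJN N,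
        Dβ.toTheta g * (s₀ ⟨Dβ.aug g, Dβ.GJN_le_GKN N h'⟩)⁻¹ ∈ Dβ.thetaPowersY N)
    (Eα : Dα.EtaleThetaData) (Eβ : Dβ.EtaleThetaData) (hCα : Dα.Compat) (hCβ : Dβ.Compat)
    (hSβ : Dβ.Sec2Hyps) (h15iiα : ThetaSetting.Prop15ii Eα.toKummerData hCα)
    (h15ii : ThetaSetting.Prop15ii Eβ.toKummerData hCβ)
    (h15α : ThetaSetting.Prop15iii Eα hCα) (h15β : ThetaSetting.Prop15iii Eβ hCβ)
    {σ : Dβ.PiTemp} (hσ : σ ∈ Dβ.GtpYdd)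
    (Vα : ThetaSetting.ValuationHatData Dα Eα.toKummerData)
    (Vβ : ThetaSetting.ValuationHatData Dβ Eβ.toKummerData)
    (hVα : Vα.unitsHat = Dα.unitsOKdd.map Eα.toKddHat) (hVβ : Vβ.unitsHat = Dβ.unitsOKdd.map Eβ.toKddHat)
    (h16ii : ThetaSetting.Thm16ii γ h Eα.toKummerData Eβ.toKummerData Vα Vβ)
    (hTβ : Dβ.HasThetaTopology) (hOβ : Dβ.IsEtThOrigin)
    {lamβ : ↥((Dβ.DtpYddN 1).map Dβ.toTheta) →ₜ* Dβ.DeltaTheta} (hstdβ : ThetaSetting.IsStdLog lamβ)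
    (hresβ : ContH1.res (MonoidHom.id Dβ.GtpTheta) Dβ.DeltaTheta Dβ.map_toTheta_DtpYddN_one_le Eβ.logUdd =
      ThetaSetting.homClass ThetaSetting.dtpYddTheta_le_deltaTheta_map lamβ)
    {ια : Dα.PiTemp ≃ₜ* Dα.PiTemp} (hια : Dα.IsInversionAut ια) (cα : ThetaSetting.ThetaCompanion ια)
    (hInvα : ThetaSetting.InvClauses Eα hια cα)
    (h15invβ : Dβ.Prop15iiiInvAnchored Eβ)
    (yβ : ThetaSetting.CuspidalPointDd Eβ.toKummerData) (hyβA : yβ.IsAnchored) (hyβ0 : yβ.IsOnLabelZero)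
    (hyβfix : Dβ.FixesCuspBelow ((γ.symm.trans ια).trans γ) yβ)
    (y : ThetaSetting.CuspidalPointDd Eβ.toKummerData) {u₁ u₂ v₁ v₂ : (↥Dβ.Kdd)ˣ}
    (hu₁ : u₁ ∈ Dβ.unitsOKdd) (hu₂ : u₂ ∈ Dβ.unitsOKdd)
    (hv : ‖((v₁ : Dβ.Kdd) : PadicAlgCl p)‖ = ‖((v₂ : Dβ.Kdd) : PadicAlgCl p)‖)
    (h₁ : haveI := hCβ.GtpYdd_normal
      y.evalAt (ContH1.res Dβ.toTheta Dβ.DeltaTheta (y.sec_le.trans y.Dpt_le)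
        (ContH1.conj Dβ.toTheta Dβ.DeltaTheta σ Eβ.etaDd)) = Eβ.toKddHat (u₁ * v₁))
    (h₂ : y.evalAt (ContH1.res Dβ.toTheta Dβ.DeltaTheta (y.sec_le.trans y.Dpt_le)
        (ThetaSetting.transport c h Eα.etaDd)) = Eβ.toKddHat (u₂ * v₂)) :
    ThetaSetting.Thm16iii γ h c Eα Eβ hCβ :=
  thm16iii_of_isKernelOfAction_of_znDef h c hΔ (hα.map_GtpY_eq hβ γ) hTα.gknIsKernelOfAction hTβ'.gknIsKernelOfAction
    hsc hα.gtpYN_fromCusp hβ.gtpYN_fromCusp h65 hα.exists_cuspidal_le_GtpY hcenα hexα hcenβ hexβ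
    Eα Eβ hCα hCβ hSβ h15iiα h15ii h15α h15β hσ Vα Vβ hVα hVβ h16ii
    hTβ hOβ hstdβ hresβ hια cα hInvα h15invβ yβ hyβA hyβ0 hyβfix y hu₁ hu₂ hv h₁ h₂

end Thm16Sub

end Literature.AnabelianGeometry.EtaleTheta

end
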